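import Summits.BirchSwinnertonDyer.Rank1Residual.O6.KatoHullRankOneDescent
import Summits.BirchSwinnertonDyer.Rank1Residual.O6.PotGoodOfHullKMC
import Summits.BirchSwinnertonDyer.Rank1Residual.Additive.O7RankOneCells
import HarnessLib

/-!
# O6 / O5 / B8: the rank-ONE DescentGlue `KMC_p ∧ PR^× ⟹ BSD_p` IN HULL CURRENCY — no torsion-free
# member, no Mazur–Kenku walk, no image hypothesis (cell `bsd-potss`, seat `kmc`, generation 8; part
# 15b-iii of the descent files; kernel assemblies over parts 14e / 15b-i,ii; nothing asserted)

The K9 / K8-t′ routes' declared residuals `WildRankOne` (stmt-…-19200) / `TameRankOne` (stmt-…-19984)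
have as two-layer parent the kernel glue of part 10 (`o6Sharp_of_kmc_torsionFree`,
`Additive.potGoodLowerHalfRankZero_of_kmc_torsionFree`): Kato's Main Conjecture and Perrin-Riou's
formula up to a unit at the `p`-TORSION-FREE member of the class (which exists by the Mazur–Kenku walk,
named fact `mazurKenku_exists_cyclic_isogeny`) over the torsion-free readings, then Cassels. With the
exact RANK-ONE count at an arbitrary member (part 15b-i/ii: `KatoHull.rankOne_bsdp_of_kmc_of_perrinRiou`
— `KMC_p(W') ∧ PR^×(W') ⟹ BSD_p(W')` at ANY hull-realised member `W'`, torsion or not) the torsion-free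
detour is unnecessary, exactly as part 14e did for analytic rank `0`: this file restates the rank-one
(and rank-`≤ 1`) glue over the HULL reading family — Reading M1♯ `KatoHull.Realizable`, Reading M3♯
`KatoHull.ExactCountReading` (rank `0`), Reading M3♯-r1 `KatoHull.RankOneExactCountReading` (rank `1`),
the interface lemma `KatoHull.ReadsKMC`, and the named facts Cassels / GZK / modularity — so that ONE
realisation of `IsHullOf` (D-O6-2″) serves L₀, M, U₀ (reducible rows), the rank-one residuals and the
member-wise `KMC ⟺ BSD_p` at once, and `mazurKenku_exists_cyclic_isogeny` leaves every glue of the two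
routes. CONDITIONAL over displayed readings / named facts and the two conjectures KMC, PR^× (audit
`proof.conditional`); nothing about Kato's objects, his Main Conjecture or Perrin-Riou's conjecture is
asserted; no node or item is closed; nothing is booked.

Contents (§5 of part 15): `rankOne_bsdp_potGood_of_hullKMC_of_perrinRiou` (every additive potentially
good `r_an = 1` curve), `bsdp_potGood_of_hullKMC_of_perrinRiou` (`r_an ≤ 1`), `o6Sharp_of_hullKMC_of_perrinRiou`
(the K9 leaf), `O7.pPartSS_of_hullKMC_of_perrinRiou` (B8 = KMC + PR^× class-wide, no image restriction),
`o5Sharp_of_hullKMC_of_perrinRiou`, `KatoHull.perrinRiou_iff_of_isIsogenous_of_kmc` (PR^× is a class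
invariant granted KMC); the route-typed residual shapes `WildRankOne` (19200) / `TameRankOne` (19984) are
the Theorems-side helpers `KatoDescentPotSupersingularWildRankOneOfHullKMC.lean` /
`KatoDescentTamePotSupersingularTameRankOneOfHullKMC.lean`.

References: [Kato2004Asterisque] Conj. 12.10 (p. 224), §14.14 (p. 243), Prop. 14.16 (2) (p. 244);
[BurnsKuriharaSano2019] Conj. 1.5 (p. 5), Thm. 7.6, Rem. 7.7 (p. 29); [Wuthrich2014] §3.2 (p. 394);
[SilvermanAEC2009] III.4.12, Rem. III.4.13.2; [Cassels1965ArithmeticVIII]; [Miller2011LMS] Def. 1.1.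
-/

set_option autoImplicit false

noncomputable section

open scoped Classical

open WeierstrassCurve Literature.NumberTheory.EllipticCurves
  Literature.NumberTheory.EllipticCurves.ModularForms
  Literature.NumberTheory.EllipticCurves.Rank1Residual
  Literature.NumberTheory.EllipticCurves.Rank1Residual.Typed
  Literature.NumberTheory.EllipticCurves.IwasawaAlgebra

/-! ## §5 The rank-one DescentGlue in hull currency (no torsion-free member, no Mazur–Kenku) -/

namespace Summit.BirchSwinnertonDyer.Rank1Residual.Additive

variable {IsHullOf : ∀ (W : WeierstrassCurve ℚ) [W.IsElliptic] [W.IsGloballyMinimal] (p : ℕ)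
  [Fact p.Prime], KatoHullDescentDatum p → Prop}
variable {PRRatio : ∀ (W : WeierstrassCurve ℚ) [W.IsElliptic] [W.IsGloballyMinimal] (p : ℕ)
  [Fact p.Prime], ℚ_[p] → Prop}
variable {KMC : ∀ (W : WeierstrassCurve ℚ) [W.IsElliptic] [W.IsGloballyMinimal] (p : ℕ), Prop}

/-- **`KMC_p ∧ PR^× ⟹ BSD_p` ON EVERY ADDITIVE POTENTIALLY GOOD CURVE OF ANALYTIC RANK `1`, IN HULL
CURRENCY.** Granted Reading M1♯ (a hull datum at some isogenous `W'`), Reading M3♯-r1, the interface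
lemma `ReadsKMC`, the named facts Cassels / GZK / modularity, and KMC ∧ PR^× at every additive
potentially good curve of analytic rank `1` (hypothesis `hKP`): `BSDp W p`. Proof: at the realised
member `W'` (`KatoHull.rankOne_bsdp_of_kmc_of_perrinRiou`, ANY torsion), then Cassels
(`N10.bsdp_of_isIsogenous_of_bsdp`). Replaces part 10's torsion-free glue (`Addv.exists_torsionFree_member`
by the Mazur–Kenku walk). Conditional over displayed hypotheses; nothing asserted.
[cite: BurnsKuriharaSano2019, Thm. 7.6 (p. 29)] [cite: Kato2004Asterisque, Conj. 12.10 (p. 224)] [cite: Cassels1965ArithmeticVIII] -/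
theorem rankOne_bsdp_potGood_of_hullKMC_of_perrinRiou (hRz : KatoHull.Realizable IsHullOf)
    (hC : KatoHull.RankOneExactCountReading IsHullOf PRRatio) (hK : KatoHull.ReadsKMC IsHullOf KMC)
    (hCassels : bsdRHS_eq_of_isIsogenous) (hGZK : rank_eq_analyticRank_of_analyticRank_le_one)
    (hmod : hasEntireLFunction_rat)
    (hKP : ∀ (W : WeierstrassCurve ℚ) [W.IsElliptic] [W.IsGloballyMinimal] (p : ℕ) [Fact p.Prime],
      W.analyticRank = 1 → p ≠ 2 → Addv W p → 0 ≤ padicValRat p W.j →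
        KMC W p ∧ PerrinRiouUpToUnitAt PRRatio W p)
    (W : WeierstrassCurve ℚ) [W.IsElliptic] [W.IsGloballyMinimal] (p : ℕ) [Fact p.Prime]
    (hr : W.analyticRank = 1) (hp : p ≠ 2) (hadd : Addv W p) (hj : 0 ≤ padicValRat p W.j) :
    BSDp W p := by
  obtain ⟨W', hE', hM', hiso, D, hDof⟩ := hRz W p hp hadd hj
  obtain ⟨hadd', hj'⟩ := Addv.of_isIsogenous_of_padicValRat_j_nonneg (p := p) hadd hj hiso
  have hr' : W'.analyticRank = 1 := by rw [← analyticRank_eq_of_isIsogenous' hiso, hr]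
  obtain ⟨hkmc', hPR'⟩ := hKP W' p hr' hp hadd' hj'
  have hbsd' : BSDp W' p :=
    KatoHull.rankOne_bsdp_of_kmc_of_perrinRiou hC hK hGZK hmod hp hadd' hj' hr' hDof hkmc' hPR'
  exact N10.bsdp_of_isIsogenous_of_bsdp p hCassels hGZK hmod hiso (by rw [hr]) hbsd'

/-- **Analytic rank `≤ 1` at once: `KMC_p (∧ PR^× in rank one) ⟹ BSD_p` on every additive potentially
good curve, in hull currency** (parts 14e + 15: Readings M1♯, M3♯, M3♯-r1, `ReadsKMC`; Cassels, GZK,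
modularity). Conditional; nothing asserted. [cite: Kato2004Asterisque, Conj. 12.10 (p. 224), Prop. 14.16 (2) (p. 244)]
[cite: BurnsKuriharaSano2019, Thm. 7.6 (p. 29)] [cite: Cassels1965ArithmeticVIII] -/
theorem bsdp_potGood_of_hullKMC_of_perrinRiou (hRz : KatoHull.Realizable IsHullOf)
    (hC0 : KatoHull.ExactCountReading IsHullOf) (hC1 : KatoHull.RankOneExactCountReading IsHullOf PRRatio)
    (hK : KatoHull.ReadsKMC IsHullOf KMC) (hCassels : bsdRHS_eq_of_isIsogenous)
    (hGZK : rank_eq_analyticRank_of_analyticRank_le_one) (hmod : hasEntireLFunction_rat)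
    (hKP : ∀ (W : WeierstrassCurve ℚ) [W.IsElliptic] [W.IsGloballyMinimal] (p : ℕ) [Fact p.Prime],
      W.analyticRank ≤ 1 → p ≠ 2 → Addv W p → 0 ≤ padicValRat p W.j →
        KMC W p ∧ (W.analyticRank = 1 → PerrinRiouUpToUnitAt PRRatio W p))
    (W : WeierstrassCurve ℚ) [W.IsElliptic] [W.IsGloballyMinimal] (p : ℕ) [Fact p.Prime]
    (hr : W.analyticRank ≤ 1) (hp : p ≠ 2) (hadd : Addv W p) (hj : 0 ≤ padicValRat p W.j) :
    BSDp W p := by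
  rcases Nat.le_one_iff_eq_zero_or_eq_one.mp hr with h0 | h1
  · exact bsdp_rankZero_potGood_of_hullKMC hRz hC0 hK hCassels hGZK hmod
      (fun V _ _ q _ hV hq hV' hVj ↦ (hKP V q (by rw [hV]; exact zero_le_one) hq hV' hVj).1) W p h0 hp
      hadd hj
  · exact rankOne_bsdp_potGood_of_hullKMC_of_perrinRiou hRz hC1 hK hCassels hGZK hmod
      (fun V _ _ q _ hV hq hV' hVj ↦
        ⟨(hKP V q (by rw [hV]) hq hV' hVj).1, (hKP V q (by rw [hV]) hq hV' hVj).2 hV⟩) W p h1 hp hadd hj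

/-- **O6♯ (the K9 leaf `Additive.O6Sharp`) from KMC₃ ∧ PR^× in hull currency** — supersedes part 10's
`o6Sharp_of_kmc_torsionFree` (torsion-free readings + Mazur–Kenku): over Readings M1♯ / M3♯ / M3♯-r1 /
`ReadsKMC` and Cassels / GZK / modularity, Kato's Main Conjecture at every member `W'` of a wild class
of analytic rank `≤ 1` and Perrin-Riou's formula up to a unit there in analytic rank `1` (hypothesis
`hKP`, stated on the class as in part 10) give `O6Sharp`. Conditional; nothing asserted; the conjecture
is not closed. [cite: Kato2004Asterisque, Conj. 12.10 (p. 224)] [cite: BurnsKuriharaSano2019, Conj. 1.5 (p. 5), Thm. 7.6 (p. 29)]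
[cite: Cassels1965ArithmeticVIII] -/
theorem o6Sharp_of_hullKMC_of_perrinRiou (hRz : KatoHull.Realizable IsHullOf)
    (hC0 : KatoHull.ExactCountReading IsHullOf) (hC1 : KatoHull.RankOneExactCountReading IsHullOf PRRatio)
    (hK : KatoHull.ReadsKMC IsHullOf KMC) (hCassels : bsdRHS_eq_of_isIsogenous)
    (hGZK : rank_eq_analyticRank_of_analyticRank_le_one) (hmod : hasEntireLFunction_rat)
    (hKP : ∀ (W W' : WeierstrassCurve ℚ) [W.IsElliptic] [W.IsGloballyMinimal] [W'.IsElliptic]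
      [W'.IsGloballyMinimal] (p : ℕ) [Fact p.Prime],
      W.analyticRank ≤ 1 → ClassO6 W p → IsIsogenous W W' → Addv W' p → 0 ≤ padicValRat p W'.j →
        KMC W' p ∧ (W'.analyticRank = 1 → PerrinRiouUpToUnitAt PRRatio W' p)) :
    O6Sharp := by
  intro W _ _ p _ hr hO
  haveI : Finite W.sha := (hGZK W hr).2
  refine missingPPartAt_of_bsdp W p ?_
  obtain ⟨W', hE', hM', hiso, D, hDof⟩ := hRz W p hO.1 hO.2.1 hO.padicValRat_j_nonneg
  obtain ⟨hadd', hj'⟩ :=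
    Addv.of_isIsogenous_of_padicValRat_j_nonneg (p := p) hO.2.1 hO.padicValRat_j_nonneg hiso
  have hr' : W'.analyticRank = W.analyticRank := (analyticRank_eq_of_isIsogenous' hiso).symm
  obtain ⟨hkmc', hPR'⟩ := hKP W W' p hr hO hiso hadd' hj'
  have hbsd' : BSDp W' p := by
    rcases Nat.le_one_iff_eq_zero_or_eq_one.mp hr with h0 | h1
    · exact KatoHull.bsdp_of_kmc hC0 hK hGZK hmod hO.1 hadd' hj' (by rw [hr', h0]) hDof hkmc'
    · exact KatoHull.rankOne_bsdp_of_kmc_of_perrinRiou hC1 hK hGZK hmod hO.1 hadd' hj'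
        (by rw [hr', h1]) hDof hkmc' (hPR' (by rw [hr', h1]))
  exact N10.bsdp_of_isIsogenous_of_bsdp p hCassels hGZK hmod hiso hr hbsd'

/-- **O5♯ (the leaf `Additive.O5Sharp` of the (t′)/Gss2 sub-rungs; in particular the K8-t′ leaf
`O5SharpTprime` via `o5Sharp_iff`) from KMC_p ∧ PR^× in hull currency**: Kato's Main Conjecture at every
additive potentially good curve of analytic rank `≤ 1` and Perrin-Riou's formula up to a unit at those of
analytic rank `1` give `O5Sharp` — both halves in both ranks, with NO use of Kato's divisibility / U₀ (under
the EQUALITY 12.10 the upper half is free: `m = 0`). Conditional; nothing asserted; the conjecture is not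
closed. [cite: Kato2004Asterisque, Conj. 12.10 (p. 224)] [cite: BurnsKuriharaSano2019, Conj. 1.5 (p. 5), Thm. 7.6 (p. 29)]
[cite: Cassels1965ArithmeticVIII] -/
theorem o5Sharp_of_hullKMC_of_perrinRiou (hRz : KatoHull.Realizable IsHullOf)
    (hC0 : KatoHull.ExactCountReading IsHullOf) (hC1 : KatoHull.RankOneExactCountReading IsHullOf PRRatio)
    (hK : KatoHull.ReadsKMC IsHullOf KMC) (hCassels : bsdRHS_eq_of_isIsogenous)
    (hGZK : rank_eq_analyticRank_of_analyticRank_le_one) (hmod : hasEntireLFunction_rat)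
    (hKP : ∀ (W : WeierstrassCurve ℚ) [W.IsElliptic] [W.IsGloballyMinimal] (p : ℕ) [Fact p.Prime],
      W.analyticRank ≤ 1 → p ≠ 2 → Addv W p → 0 ≤ padicValRat p W.j →
        KMC W p ∧ (W.analyticRank = 1 → PerrinRiouUpToUnitAt PRRatio W p)) :
    O5Sharp := by
  intro W _ _ p _ hr hO
  haveI : Finite W.sha := (hGZK W hr).2
  exact missingPPartAt_of_bsdp W p
    (bsdp_potGood_of_hullKMC_of_perrinRiou hRz hC0 hC1 hK hCassels hGZK hmod hKP W p hr hO.1 hO.2.1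
      hO.padicValRat_j_nonneg)

/-- **B8 = O7-ss (the conjecture `O7.PPartSS`, EVERY row — no image restriction) from KMC_p ∧ PR^× in
hull currency**: on every analytic-rank-one pair of the O7-ss locus (`O7.SS W p`: odd additive `p` of
potentially supersingular type), Kato's Main Conjecture and Perrin-Riou's formula up to a unit at the
additive potentially good rank-one curves give `MissingPPartAt`. Part 6's `O7.pPartSS_bigImage_…` had
(12.5.2); part 10 had the torsion-free member; here neither. RESIDUAL-MAP §I O7-ss "nothing formulated
in print": in Kato's currency the cell = exactly two named conjectures (Kato Conj. 12.10,
Burns–Kurihara–Sano Conj. 1.5 / Perrin-Riou) over the hull readings. Conditional; nothing asserted.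
[cite: Kato2004Asterisque, Conj. 12.10 (p. 224)] [cite: BurnsKuriharaSano2019, Conj. 1.5 (p. 5), Thm. 7.6 (p. 29)] [cite: Cassels1965ArithmeticVIII] -/
theorem O7.pPartSS_of_hullKMC_of_perrinRiou (hRz : KatoHull.Realizable IsHullOf)
    (hC : KatoHull.RankOneExactCountReading IsHullOf PRRatio) (hK : KatoHull.ReadsKMC IsHullOf KMC)
    (hCassels : bsdRHS_eq_of_isIsogenous) (hGZK : rank_eq_analyticRank_of_analyticRank_le_one)
    (hmod : hasEntireLFunction_rat)
    (hKP : ∀ (W : WeierstrassCurve ℚ) [W.IsElliptic] [W.IsGloballyMinimal] (p : ℕ) [Fact p.Prime],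
      W.analyticRank = 1 → p ≠ 2 → Addv W p → 0 ≤ padicValRat p W.j →
        KMC W p ∧ PerrinRiouUpToUnitAt PRRatio W p) :
    O7.PPartSS := by
  intro W _ _ p _ hr hss
  haveI : Finite W.sha := (hGZK W (by rw [hr])).2
  exact missingPPartAt_of_bsdp W p
    (rankOne_bsdp_potGood_of_hullKMC_of_perrinRiou hRz hC hK hCassels hGZK hmod hKP W p hr hss.addv.1
      hss.addv.2 hss.padicValRat_j_nonneg)

end Summit.BirchSwinnertonDyer.Rank1Residual.Additive

namespace Summit.BirchSwinnertonDyer.Rank1Residual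

open Additive

variable {IsHullOf : ∀ (W : WeierstrassCurve ℚ) [W.IsElliptic] [W.IsGloballyMinimal] (p : ℕ)
  [Fact p.Prime], KatoHullDescentDatum p → Prop}
variable {PRRatio : ∀ (W : WeierstrassCurve ℚ) [W.IsElliptic] [W.IsGloballyMinimal] (p : ℕ)
  [Fact p.Prime], ℚ_[p] → Prop}
variable {KMC : ∀ (W : WeierstrassCurve ℚ) [W.IsElliptic] [W.IsGloballyMinimal] (p : ℕ), Prop}

/-- **PR^× is an invariant of the isogeny class, granted KMC at two realised members**: for isogenous
hull-realised members `W ∼ W'` of analytic rank one with Kato's Main Conjecture at both,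
`PerrinRiouUpToUnitAt W p ⟺ PerrinRiouUpToUnitAt W' p` — although `ord_p(L′/(Ω·Reg))` itself is NOT an
isogeny invariant (it moves by `2(t(W′) − t(W))` minus the Tamagawa change; STEP-0 j251112: by `p²` along
a `9`-isogeny chain). Proof: `BSD_p ⟺ PR^×` at each member (`KatoHull.missingPPartAt_iff_perrinRiou_of_kmc`)
and Cassels (`N10.bsdp_of_isIsogenous_of_bsdp`, both directions). On rows with `W[p]` irreducible every
member is realisable (part 14f's `KatoHull.RealizableOfIrr`), so there PR^× is a class invariant granted
KMC. Conditional over displayed readings; nothing asserted. [cite: BurnsKuriharaSano2019, Conj. 1.5 (p. 5), Thm. 7.3 (p. 29)]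
[cite: Cassels1965ArithmeticVIII] [cite: Kato2004Asterisque, Conj. 12.10 (p. 224)] -/
theorem KatoHull.perrinRiou_iff_of_isIsogenous_of_kmc
    (hC : KatoHull.RankOneExactCountReading IsHullOf PRRatio) (hrat : KatoHull.HasPRRatio PRRatio)
    (hK : KatoHull.ReadsKMC IsHullOf KMC) (hCassels : bsdRHS_eq_of_isIsogenous)
    (hGZK : rank_eq_analyticRank_of_analyticRank_le_one) (hmod : hasEntireLFunction_rat)
    {W W' : WeierstrassCurve ℚ} [W.IsElliptic] [W.IsGloballyMinimal] [W'.IsElliptic]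
    [W'.IsGloballyMinimal] {p : ℕ} [Fact p.Prime] {D D' : KatoHullDescentDatum p} (hp : p ≠ 2)
    (hadd : Addv W p) (hj : 0 ≤ padicValRat p W.j) (hr : W.analyticRank = 1) (hiso : IsIsogenous W W')
    (hDof : IsHullOf W p D) (hDof' : IsHullOf W' p D') (hkmc : KMC W p) (hkmc' : KMC W' p) :
    PerrinRiouUpToUnitAt PRRatio W p ↔ PerrinRiouUpToUnitAt PRRatio W' p := by
  obtain ⟨hadd', hj'⟩ := Addv.of_isIsogenous_of_padicValRat_j_nonneg (p := p) hadd hj hiso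
  have hr' : W'.analyticRank = 1 := by rw [← analyticRank_eq_of_isIsogenous' hiso, hr]
  haveI : Finite W.sha := (hGZK W (by rw [hr])).2
  haveI : Finite W'.sha := (hGZK W' (by rw [hr'])).2
  rw [← KatoHull.missingPPartAt_iff_perrinRiou_of_kmc hC hrat hK hGZK hmod hp hadd hj hr hDof hkmc,
    ← KatoHull.missingPPartAt_iff_perrinRiou_of_kmc hC hrat hK hGZK hmod hp hadd' hj' hr' hDof' hkmc']
  constructor
  · intro h
    exact missingPPartAt_of_bsdp W' p (N10.bsdp_of_isIsogenous_of_bsdp p hCassels hGZK hmod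
      hiso.symm_of_isElliptic (by rw [hr']) (bsdp_of_missingPPartAt W p hGZK (by rw [hr]) h))
  · intro h
    exact missingPPartAt_of_bsdp W p (N10.bsdp_of_isIsogenous_of_bsdp p hCassels hGZK hmod hiso
      (by rw [hr]) (bsdp_of_missingPPartAt W' p hGZK (by rw [hr']) h))

end Summit.BirchSwinnertonDyer.Rank1Residual

end
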